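import Summits.QuantumFields.BalabanUV.Beta.CapRouteA
import Summits.QuantumFields.BalabanUV.Beta.CapRowsQhalf
import Summits.QuantumFields.BalabanUV.Beta.ConjReflectionAlgebra

/-!
# Beta / CapRouteAWords — ROUTE A FOR TRACE WORDS: the row's integrand template generalised from the two-term one-loop form
# `tr(A⁻¹B) − tr(A⁻¹CA′⁻¹D)` to ANY finite real combination of traces of alternating words `X T₁ X T₂ ⋯ X T_m` (`X = A(q)⁻¹`)
# (β sub-cell, BINDER-OWNERS row CAP-k, lineage `b2b-balaban-beta-an5`, gen 26; node BETA-an5-g26-SCHEDULES, leaf 7; journal l.17735 ∕ l.18638)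

The certificate-currency anchors of the row (`CapRouteA…` gens 21–26) type the integrand as the TWO-TERM one-loop form `t₁ − t₂ = tr(X S_st) −
tr(X S_s X′ S_t)` (at most two resolvent factors per trace word).  The engines' ACTUAL integrand — the jet functional of B12 (1.22) at zero
external momentum, with the `p`-derivatives carried by derivative tables — expands into a finite real combination of traces of ALTERNATING
WORDS `X T₁ X T₂ ⋯ X T_m` with up to FOUR propagators (CAP-KERNEL §4.22 (c)(d): 3 + 36 trace terms, 99 cyclic words, worst word
`k_{s,A,0}·k₁·k₂·k_{t,A,0}`).  THIS LEAF makes such word sums a first-class integrand of the row, with the SAME certificate inputs: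

* §1 `wordProd A T w q = Π_{i ∈ w} (A q)⁻¹ · T i q` (alternating word over a letter list `w : List ι` of table families `T : ι → _`),
  `wordSum A T W q = Σ_{(c, w) ∈ W} c · tr(wordProd A T w q)` (real coefficients); STRUCTURE: `matTubeHol_wordProd`, `tubeHol_wordSum` (tube
  holomorphy under (Z1)), `matConjSymm_wordProd`, `conjSymm_wordSum` (reality from `MatConjSymm A`, `MatConjSymm (T i)` — so `hsym` is FREE);
* §2 NORMS: `wordBound Ba S w = Π_{i ∈ w} Ba·S_i`, `norm_wordProd_le`, `wordSumBound`, `norm_wordSum_le` — route A's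
  product-of-norms master bound for words (the L2w ∕ L1n class of §4.22; this does NOT improve the price: floor `N ≥ 8–9` stands);
* §3 THE BINDER: **`stripRegularC_wordSum_ofVertexTori`** — STRUCTURE + (Z1) on `Strip (d+1) κ` + `hBa : ‖(A q)⁻¹‖ ≤ Ba` and table sups
  `‖T i q‖ ≤ S i` ON THE VERTEX TORI ⟹ `StripRegularC (wordSum A T W) κ (wordSumBound n Ba S W)`;
* §4 THE ROWS (code16, engine convention): **`rowsOfWordSumCode16E`** (complex ball) and **`rowsOfWordSumCode16E_ofRealBall`** (the engines'
  REAL ball; reality discharged from `MatConjSymm`), `k₀ = 0`.  The certificate-currency END (box schedules + records, fin records) is the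
  companion `CapRouteAWordsRecords`.

HONEST FRAMING.  Kernel glue ([folklore] linear algebra over the tree's `TubeHolAlgebra` ∕ `ConjReflectionAlgebra` ∕ `CapRowsQhalf`); no word
list for the cell's functional is typed here (that is the dictionary's ∕ cap lanes' table-level object), no number supplied; the constant is
route A's crude product-of-norms number; 0 binders instantiated; 0 certified coefficients.  Discharging `BetaPertH` would make Bałaban's
ultraviolet stability unconditional — NOT the continuum limit, NOT the Clay problem.  0 `sorry`, 0 cite tags.
-/

namespace Summit.QuantumFields.BalabanUV.Beta.CapRouteAWords

open Complex Set Matrix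
open Literature.MathematicalPhysics.QuantumFieldTheory.Balaban1983to89
open B4Strip (Strip ofRealVec)
open B4ContourShift (latticeKernel)
open B4TorusKernel (descend gridPt)
open Beta.AliasingTailL1 (aliasRatioL1 StripRegularC PolyStrip)
open Beta.AliasingTailLattice (codeTheta code16SetE)
open Summit.QuantumFields.BalabanUV.Beta.CapRows (Rows)
open Summit.QuantumFields.BalabanUV.Beta.TubeMaximumModulus
open Summit.QuantumFields.BalabanUV.Beta.ConjReflectionAlgebra (ConjSymm MatConjSymm conjSymm_const matConjSymm_const)
open Summit.QuantumFields.BalabanUV.Beta.CapRouteA (norm_trace_mul_le)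
open Summit.QuantumFields.BalabanUV.Beta.CapRowsLattice (rowsOfCode16E)
open Summit.QuantumFields.BalabanUV.Beta.CapRowsQhalf (rowsOfCode16E_ofRealBall)
open scoped Real ComplexConjugate Matrix.Norms.L2Operator

noncomputable section

variable {d : ℕ} {n : Type*} [Fintype n] [DecidableEq n] {ι : Type*}

/-! ## §1 Alternating words and word sums; structure -/

section Words

/-- the ALTERNATING WORD `X T_{i₁} X T_{i₂} ⋯ X T_{i_m}` with `X = (A q)⁻¹`, over the letter list `w = [i₁, …, i_m]`. [folklore] -/
def wordProd (A : (Fin (d + 1) → ℂ) → Matrix n n ℂ) (T : ι → (Fin (d + 1) → ℂ) → Matrix n n ℂ) :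
    List ι → (Fin (d + 1) → ℂ) → Matrix n n ℂ
  | [], _ => 1
  | i :: w, q => (A q)⁻¹ * T i q * wordProd A T w q

/-- the WORD-SUM integrand `Σ_{(c, w) ∈ W} c · tr(wordProd A T w q)` with REAL coefficients. [folklore] -/
def wordSum (A : (Fin (d + 1) → ℂ) → Matrix n n ℂ) (T : ι → (Fin (d + 1) → ℂ) → Matrix n n ℂ) :
    List (ℝ × List ι) → (Fin (d + 1) → ℂ) → ℂ
  | [], _ => 0
  | cw :: W, q => (cw.1 : ℂ) * (wordProd A T cw.2 q).trace + wordSum A T W q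

variable {A : (Fin (d + 1) → ℂ) → Matrix n n ℂ} {T : ι → (Fin (d + 1) → ℂ) → Matrix n n ℂ} {w : Fin (d + 1) → ℝ}

/-- the empty word is the identity; a cons is `X · T_i · (rest)`. [folklore] -/
@[simp] theorem wordProd_nil (q : Fin (d + 1) → ℂ) : wordProd A T [] q = 1 := rfl

/-- unfolding a cons. [folklore] -/
@[simp] theorem wordProd_cons (i : ι) (wd : List ι) (q : Fin (d + 1) → ℂ) :
    wordProd A T (i :: wd) q = (A q)⁻¹ * T i q * wordProd A T wd q := rfl

/-- unfolding the word sum. [folklore] -/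
@[simp] theorem wordSum_nil (q : Fin (d + 1) → ℂ) : wordSum A T [] q = 0 := rfl

/-- unfolding the word sum. [folklore] -/
@[simp] theorem wordSum_cons (cw : ℝ × List ι) (W : List (ℝ × List ι)) (q : Fin (d + 1) → ℂ) :
    wordSum A T (cw :: W) q = (cw.1 : ℂ) * (wordProd A T cw.2 q).trace + wordSum A T W q := rfl

/-- STRUCTURE: words in tube-holomorphic families are tube-holomorphic under (Z1) for `A` on the period cell. [folklore] -/
theorem matTubeHol_wordProd (hA : MatTubeHol A w) (hT : ∀ i, MatTubeHol (T i) w) (hdet : ∀ p ∈ PolyStrip w, (A p).det ≠ 0) :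
    ∀ wd : List ι, MatTubeHol (wordProd A T wd) w
  | [] => by
    show MatTubeHol (fun _ => (1 : Matrix n n ℂ)) w
    exact matTubeHol_const 1 w
  | i :: wd => by
    show MatTubeHol (fun q => (A q)⁻¹ * T i q * wordProd A T wd q) w
    exact ((hA.inv hdet).mul (hT i)).mul (matTubeHol_wordProd hA hT hdet wd)

/-- STRUCTURE: the word sum is tube-holomorphic under (Z1). [folklore] -/
theorem tubeHol_wordSum (hA : MatTubeHol A w) (hT : ∀ i, MatTubeHol (T i) w) (hdet : ∀ p ∈ PolyStrip w, (A p).det ≠ 0) :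
    ∀ W : List (ℝ × List ι), TubeHol (wordSum A T W) w
  | [] => by
    show TubeHol (fun _ => (0 : ℂ)) w
    exact tubeHol_const 0 w
  | cw :: W => by
    show TubeHol (fun q => (cw.1 : ℂ) * (wordProd A T cw.2 q).trace + wordSum A T W q) w
    exact ((matTubeHol_wordProd hA hT hdet cw.2).trace.const_mul _).add (tubeHol_wordSum hA hT hdet W)

/-- REALITY: words in `MatConjSymm` families are `MatConjSymm` (the inverse needs no determinant hypothesis). [folklore] -/
theorem matConjSymm_wordProd (hA : MatConjSymm A) (hT : ∀ i, MatConjSymm (T i)) : ∀ wd : List ι, MatConjSymm (wordProd A T wd)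
  | [] => by
    show MatConjSymm (fun _ : Fin (d + 1) → ℂ => (1 : Matrix n n ℂ))
    refine matConjSymm_const ?_
    ext i j
    by_cases h : i = j
    · subst h; simp
    · simp [Matrix.one_apply_ne h]
  | i :: wd => by
    show MatConjSymm (fun q => (A q)⁻¹ * T i q * wordProd A T wd q)
    exact (hA.inv.mul (hT i)).mul (matConjSymm_wordProd hA hT wd)

/-- REALITY: the word sum (real coefficients) is `ConjSymm`; hence the binder `hsym` of the paired ∕ real-ball rows is FREE. [folklore] -/
theorem conjSymm_wordSum (hA : MatConjSymm A) (hT : ∀ i, MatConjSymm (T i)) : ∀ W : List (ℝ × List ι), ConjSymm (wordSum A T W)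
  | [] => by
    show ConjSymm (fun _ : Fin (d + 1) → ℂ => (0 : ℂ))
    exact conjSymm_const (by simp)
  | cw :: W => by
    show ConjSymm (fun q => (cw.1 : ℂ) * (wordProd A T cw.2 q).trace + wordSum A T W q)
    exact ((conjSymm_const (Complex.conj_ofReal _)).mul (matConjSymm_wordProd hA hT cw.2).trace).add (conjSymm_wordSum hA hT W)

end Words

/-! ## §2 Norm bounds: route A's product-of-norms bound for words -/

section Norms

variable {A : (Fin (d + 1) → ℂ) → Matrix n n ℂ} {T : ι → (Fin (d + 1) → ℂ) → Matrix n n ℂ}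

/-- the product bound of a word: `Π_{i ∈ w} Ba · S_i`. [folklore] -/
def wordBound (Ba : ℝ) (S : ι → ℝ) : List ι → ℝ
  | [] => 1
  | i :: wd => Ba * S i * wordBound Ba S wd

/-- the word bound is nonnegative for nonnegative data. [folklore] -/
theorem wordBound_nonneg {Ba : ℝ} {S : ι → ℝ} (hBa : 0 ≤ Ba) (hS : ∀ i, 0 ≤ S i) : ∀ wd : List ι, 0 ≤ wordBound Ba S wd
  | [] => zero_le_one
  | i :: wd => mul_nonneg (mul_nonneg hBa (hS i)) (wordBound_nonneg hBa hS wd)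

/-- **THE WORD BOUND, POINTWISE**: `‖(A q)⁻¹‖ ≤ Ba`, `‖T i q‖ ≤ S i` ⟹ `‖wordProd A T w q‖ ≤ Π_{i ∈ w} Ba·S_i` (the empty word: `‖1‖₂ ≤ 1`, the
tree's `SolovayKitaev.norm_one_le_one`, re-derived inline to keep the imports inside the β sub-cell). [folklore] -/
theorem norm_wordProd_le {q : Fin (d + 1) → ℂ} {Ba : ℝ} {S : ι → ℝ} (hBa : ‖(A q)⁻¹‖ ≤ Ba) (hS : ∀ i, ‖T i q‖ ≤ S i) :
    ∀ wd : List ι, ‖wordProd A T wd q‖ ≤ wordBound Ba S wd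
  | [] => by
    rw [wordProd_nil, wordBound, ← diagonal_one, l2_opNorm_diagonal]
    exact (pi_norm_le_iff_of_nonneg zero_le_one).mpr fun _ => by simp
  | i :: wd => by
    rw [wordProd_cons]
    have hBa0 : 0 ≤ Ba := (norm_nonneg _).trans hBa
    have hS0 : ∀ j, 0 ≤ S j := fun j => (norm_nonneg _).trans (hS j)
    calc ‖(A q)⁻¹ * T i q * wordProd A T wd q‖ ≤ ‖(A q)⁻¹ * T i q‖ * ‖wordProd A T wd q‖ := l2_opNorm_mul _ _
      _ ≤ (‖(A q)⁻¹‖ * ‖T i q‖) * ‖wordProd A T wd q‖ :=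
          mul_le_mul_of_nonneg_right (l2_opNorm_mul _ _) (norm_nonneg _)
      _ ≤ (Ba * S i) * wordBound Ba S wd :=
          mul_le_mul (mul_le_mul hBa (hS i) (norm_nonneg _) hBa0) (norm_wordProd_le hBa hS wd) (norm_nonneg _)
            (mul_nonneg hBa0 (hS0 i))

/-- the word-sum bound: `Σ_{(c, w) ∈ W} |c| · |n| · Π_{i ∈ w} Ba·S_i`. [folklore] -/
def wordSumBound (n : Type*) [Fintype n] (Ba : ℝ) (S : ι → ℝ) : List (ℝ × List ι) → ℝ
  | [] => 0
  | cw :: W => |cw.1| * (Fintype.card n * wordBound Ba S cw.2) + wordSumBound n Ba S W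

/-- **THE WORD-SUM BOUND, POINTWISE** (route A's master bound for words; the trace step `|tr M| ≤ |n|·‖M‖₂` is the tree's
`QuantumLattice.norm_trace_le_card_mul_norm`, taken here through `CapRouteA.norm_trace_mul_le M 1` to keep the imports inside the β sub-cell).
[folklore] -/
theorem norm_wordSum_le {q : Fin (d + 1) → ℂ} {Ba : ℝ} {S : ι → ℝ} (hBa : ‖(A q)⁻¹‖ ≤ Ba) (hS : ∀ i, ‖T i q‖ ≤ S i) :
    ∀ W : List (ℝ × List ι), ‖wordSum A T W q‖ ≤ wordSumBound n Ba S W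
  | [] => by rw [wordSum_nil, norm_zero]; exact le_rfl
  | cw :: W => by
    rw [wordSum_cons]
    refine (norm_add_le _ _).trans (add_le_add ?_ (norm_wordSum_le hBa hS W))
    rw [norm_mul, Complex.norm_real, Real.norm_eq_abs]
    refine mul_le_mul_of_nonneg_left ?_ (abs_nonneg _)
    -- `|tr P| ≤ |n|·‖P‖·‖1‖ ≤ |n|·‖P‖·1` with `P` the word, `‖1‖₂ ≤ 1` = the empty-word bound
    have h1 : ‖wordProd A T [] q‖ ≤ wordBound Ba S [] := norm_wordProd_le hBa hS []
    rw [wordProd_nil, wordBound] at h1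
    have htr := norm_trace_mul_le (wordProd A T cw.2 q) 1
    rw [Matrix.mul_one] at htr
    refine htr.trans (mul_le_mul_of_nonneg_left ?_ (Nat.cast_nonneg _))
    calc ‖wordProd A T cw.2 q‖ * ‖(1 : Matrix n n ℂ)‖ ≤ wordBound Ba S cw.2 * 1 :=
          mul_le_mul (norm_wordProd_le hBa hS cw.2) h1 (norm_nonneg _)
            (wordBound_nonneg ((norm_nonneg _).trans hBa) (fun j => (norm_nonneg _).trans (hS j)) cw.2)
      _ = wordBound Ba S cw.2 := mul_one _

end Norms

/-! ## §3 The binder: `StripRegularC (wordSum A T W) κ M` from vertex-tori data -/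

section Binder

variable {A : (Fin (d + 1) → ℂ) → Matrix n n ℂ} {T : ι → (Fin (d + 1) → ℂ) → Matrix n n ℂ} {κ Ba : ℝ} {S : ι → ℝ}

/-- **ROUTE A's BINDER FOR WORD SUMS**: STRUCTURE `MatTubeHol` of `A` and of every table family at width `κ`, (Z1) `det ≠ 0` on
`Strip (d+1) κ`, and ON THE VERTEX TORI the resolvent bound `‖(A q)⁻¹‖ ≤ Ba` and the table sups `‖T i q‖ ≤ S i` ⟹
`StripRegularC (wordSum A T W) κ (wordSumBound n Ba S W)` (maximum principle `TubeHol.stripRegularC_of_vertexTori`). [folklore] -/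
theorem stripRegularC_wordSum_ofVertexTori (hA : MatTubeHol A (fun _ => κ)) (hT : ∀ i, MatTubeHol (T i) (fun _ => κ))
    (hdet : ∀ p ∈ Strip (d + 1) κ, (A p).det ≠ 0)
    (hBa : ∀ q ∈ VertexTori (fun _ : Fin (d + 1) => κ), ‖(A q)⁻¹‖ ≤ Ba)
    (hS : ∀ i, ∀ q ∈ VertexTori (fun _ : Fin (d + 1) => κ), ‖T i q‖ ≤ S i) (W : List (ℝ × List ι)) :
    StripRegularC (wordSum A T W) κ (wordSumBound n Ba S W) :=
  (tubeHol_wordSum hA hT hdet W).stripRegularC_of_vertexTori fun q hq => norm_wordSum_le (hBa q hq) (fun i => hS i q hq) W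

end Binder

/-! ## §4 The rows on word sums (code16, engine convention) -/

section Rows

variable {b : ℕ → ℝ} {A : (Fin 4 → ℂ) → Matrix n n ℂ} {T : ι → (Fin 4 → ℂ) → Matrix n n ℂ} {κ Ba : ℝ} {S : ι → ℝ}

/-- **THE WORD-SUM ANCHOR ON ROUTE A** (complex ball): (N) `hb`; STRUCTURE; (Z1) `hdet` on `Strip 4 κ`; (Z2a) `hBa` and (Z2b) table sups
`hS` ON THE VERTEX TORI; (T) `hT` the two-engine ball on `code16SetE N`; (A) `hA₀` with `M := wordSumBound n Ba S W`; cmp `hlo` ⟹ `Rows b`,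
`k₀ = 0`. [folklore] -/
def rowsOfWordSumCode16E (W : List (ℝ × List ι)) (hb : b 0 = (latticeKernel (wordSum A T W) 0).re) (hκ : 0 < κ)
    (hA : MatTubeHol A (fun _ => κ)) (hT' : ∀ i, MatTubeHol (T i) (fun _ => κ))
    (hdet : ∀ p ∈ Strip (3 + 1) κ, (A p).det ≠ 0)
    (hBa : ∀ q ∈ VertexTori (fun _ : Fin (3 + 1) => κ), ‖(A q)⁻¹‖ ≤ Ba)
    (hS : ∀ i, ∀ q ∈ VertexTori (fun _ : Fin (3 + 1) => κ), ‖T i q‖ ≤ S i)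
    {N : ℕ} (hN : 1 ≤ N) [NeZero (4 * N)] {t r : ℝ}
    (hT : ‖((code16SetE N).card : ℂ)⁻¹ * (∑ w ∈ code16SetE N, descend (wordSum A T W) (gridPt (4 * N) w)) - t‖ ≤ r)
    {A₀ : ℝ} (hA₀ : wordSumBound n Ba S W * codeTheta (aliasRatioL1 κ N) ≤ A₀) (lo : ℚ) (hlo : ((lo : ℚ) : ℝ) ≤ t - r - A₀) :
    Rows b :=
  rowsOfCode16E hb (stripRegularC_wordSum_ofVertexTori hA hT' hdet hBa hS W) hκ hN hT hA₀ lo hlo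

/-- its level is `k₀ = 0`. [folklore] -/
theorem rowsOfWordSumCode16E_k₀ (W : List (ℝ × List ι)) (hb : b 0 = (latticeKernel (wordSum A T W) 0).re) (hκ : 0 < κ)
    (hA : MatTubeHol A (fun _ => κ)) (hT' : ∀ i, MatTubeHol (T i) (fun _ => κ))
    (hdet : ∀ p ∈ Strip (3 + 1) κ, (A p).det ≠ 0)
    (hBa : ∀ q ∈ VertexTori (fun _ : Fin (3 + 1) => κ), ‖(A q)⁻¹‖ ≤ Ba)
    (hS : ∀ i, ∀ q ∈ VertexTori (fun _ : Fin (3 + 1) => κ), ‖T i q‖ ≤ S i)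
    {N : ℕ} (hN : 1 ≤ N) [NeZero (4 * N)] {t r : ℝ}
    (hT : ‖((code16SetE N).card : ℂ)⁻¹ * (∑ w ∈ code16SetE N, descend (wordSum A T W) (gridPt (4 * N) w)) - t‖ ≤ r)
    {A₀ : ℝ} (hA₀ : wordSumBound n Ba S W * codeTheta (aliasRatioL1 κ N) ≤ A₀) (lo : ℚ) (hlo : ((lo : ℚ) : ℝ) ≤ t - r - A₀) :
    (rowsOfWordSumCode16E W hb hκ hA hT' hdet hBa hS hN hT hA₀ lo hlo).k₀ = 0 := rfl

/-- **THE WORD-SUM ANCHOR WITH THE ENGINES' REAL BALL**: as above with the (T) binder := the REAL ball `|(|S_E|⁻¹·Σ_{S_E} Re g) − t| ≤ r`;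
the reality of `g` on real momenta is DISCHARGED from `MatConjSymm A` and `MatConjSymm (T i)` (`conjSymm_wordSum`) — no `hsym` binder.
[folklore] -/
def rowsOfWordSumCode16E_ofRealBall (W : List (ℝ × List ι)) (hb : b 0 = (latticeKernel (wordSum A T W) 0).re) (hκ : 0 < κ)
    (hA : MatTubeHol A (fun _ => κ)) (hT' : ∀ i, MatTubeHol (T i) (fun _ => κ))
    (rA : MatConjSymm A) (rT : ∀ i, MatConjSymm (T i))
    (hdet : ∀ p ∈ Strip (3 + 1) κ, (A p).det ≠ 0)
    (hBa : ∀ q ∈ VertexTori (fun _ : Fin (3 + 1) => κ), ‖(A q)⁻¹‖ ≤ Ba)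
    (hS : ∀ i, ∀ q ∈ VertexTori (fun _ : Fin (3 + 1) => κ), ‖T i q‖ ≤ S i)
    {N : ℕ} (hN : 1 ≤ N) [NeZero (4 * N)] {t r : ℝ}
    (hTre : |((code16SetE N).card : ℝ)⁻¹ * (∑ w ∈ code16SetE N, (descend (wordSum A T W) (gridPt (4 * N) w)).re) - t| ≤ r)
    {A₀ : ℝ} (hA₀ : wordSumBound n Ba S W * codeTheta (aliasRatioL1 κ N) ≤ A₀) (lo : ℚ) (hlo : ((lo : ℚ) : ℝ) ≤ t - r - A₀) :
    Rows b :=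
  rowsOfCode16E_ofRealBall hb (stripRegularC_wordSum_ofVertexTori hA hT' hdet hBa hS W) hκ (conjSymm_wordSum rA rT W).hsym hN
    hTre hA₀ lo hlo

/-- its level is `k₀ = 0`. [folklore] -/
theorem rowsOfWordSumCode16E_ofRealBall_k₀ (W : List (ℝ × List ι)) (hb : b 0 = (latticeKernel (wordSum A T W) 0).re)
    (hκ : 0 < κ) (hA : MatTubeHol A (fun _ => κ)) (hT' : ∀ i, MatTubeHol (T i) (fun _ => κ))
    (rA : MatConjSymm A) (rT : ∀ i, MatConjSymm (T i))
    (hdet : ∀ p ∈ Strip (3 + 1) κ, (A p).det ≠ 0)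
    (hBa : ∀ q ∈ VertexTori (fun _ : Fin (3 + 1) => κ), ‖(A q)⁻¹‖ ≤ Ba)
    (hS : ∀ i, ∀ q ∈ VertexTori (fun _ : Fin (3 + 1) => κ), ‖T i q‖ ≤ S i)
    {N : ℕ} (hN : 1 ≤ N) [NeZero (4 * N)] {t r : ℝ}
    (hTre : |((code16SetE N).card : ℝ)⁻¹ * (∑ w ∈ code16SetE N, (descend (wordSum A T W) (gridPt (4 * N) w)).re) - t| ≤ r)
    {A₀ : ℝ} (hA₀ : wordSumBound n Ba S W * codeTheta (aliasRatioL1 κ N) ≤ A₀) (lo : ℚ) (hlo : ((lo : ℚ) : ℝ) ≤ t - r - A₀) :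
    (rowsOfWordSumCode16E_ofRealBall W hb hκ hA hT' rA rT hdet hBa hS hN hTre hA₀ lo hlo).k₀ = 0 := rfl

/-- **THE TWO-TERM ONE-LOOP FORM IS A WORD SUM** (zero shift): `tr(X S_st) − tr(X S_s X S_t) = wordSum A T [(1, [st]), (−1, [s, t])]` for the
three-letter alphabet — so the gen-21–26 anchors are the special case of words of length ≤ 2. [folklore] -/
theorem oneLoopForm_eq_wordSum (B C D : (Fin 4 → ℂ) → Matrix n n ℂ) (q : Fin 4 → ℂ) :
    ((A q)⁻¹ * B q).trace - ((A q)⁻¹ * C q * (A q)⁻¹ * D q).trace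
      = wordSum A (fun i : Fin 3 => ![B, C, D] i) [((1 : ℝ), [(0 : Fin 3)]), ((-1 : ℝ), [(1 : Fin 3), 2])] q := by
  simp only [wordSum_cons, wordSum_nil, wordProd_cons, wordProd_nil, Matrix.mul_one, Matrix.cons_val_zero, Matrix.cons_val_one,
    Matrix.cons_val_two, Matrix.head_cons, Matrix.tail_cons, Complex.ofReal_one, Complex.ofReal_neg, one_mul, neg_one_mul, add_zero]
  rw [sub_eq_add_neg, Matrix.mul_assoc ((A q)⁻¹ * C q)]

end Rows

end

end Summit.QuantumFields.BalabanUV.Beta.CapRouteAWords
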